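import Literature.AlgebraicGeometry.Shioda1982.ExceptionalQuadruples
import HarnessLib

/-!
# Shioda 1982 / Meyer–Neutsch 1981: Tabelle 1 is COMPLETE at each of its 22 levels (kernel-checked exhaustion)

Topic `Literature/AlgebraicGeometry/Shioda1982`, companion to `ExceptionalQuadruples.lean` (the printed table `tabelleOne` /
`reps`, the predicates `HasPair`, `IsPrimitive`, `IsStandardQuadruple`, `IsExceptionalQuadruple`). DEFINITIONS (a Boolean
search procedure over `ℕ` and its pieces) and THEOREMS; no named fact, nothing assumed.

WHAT IS CERTIFIED HERE. [MeyerNeutsch1981Fermatquadrupel, §2 p. 53] report a computer determination of all "Fermatquadrupel" for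
`N ≤ 614` and print in Tabelle 1 (p. 54) one representative of each `𝔊_N × S₄`-orbit of "Ausnahmequadrupel" (exceptional
quadruples): 101 orbits at the 22 levels `N = 12, 14, 15, 18, 20, 21, 24, 28, 30, 36, 40, 42, 48, 60, 66, 72, 78, 84, 90, 120, 156, 180`;
[Shioda1982PicardFermat, table p. 727] prints the corresponding counts `Δ(m)` (from an independent computation by Shioda and
N. Maruyama), and [Aoki1983, Thm. C] proves that no exceptional element exists for `m > 180`. The base file
`ExceptionalQuadruples.lean` checks that every printed representative IS exceptional and that the printed orbits are distinct, and certifies completeness by kernel exhaustion at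
the seven levels `N ≤ 24` (`complete_twelve`, …, `complete_twentyFour`; the same formulation runs out of kernel memory at `N = 28`).
This file and its two companions `ExceptionalQuadruplesComplete120.lean` (levels `120, 156`) and
`ExceptionalQuadruplesComplete180.lean` (level `180`) certify COMPLETENESS AT ALL 22 LEVELS; this file holds the search procedure, its
soundness theorem, and the 19 levels `N ≤ 90`:

* `TabelleOneCompleteAt N` — every Hodge 4-multiset `{a, b, c, d}` of residues mod `N` (written with `⟨a⟩ ≤ ⟨b⟩ ≤ ⟨c⟩ ≤ ⟨d⟩`,
  `d = −(a+b+c)`) which has no pair `(x, −x)` and has `gcd(a, b, c, d, N) = 1` is standard (a unit multiple of `L₁, L₂` or `L₃`)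
  or a unit multiple of a representative printed in Tabelle 1 at level `N`;
* `completeAt_twelve`, …, `completeAt_ninety` — `TabelleOneCompleteAt N` for each of the 19 levels `N ≤ 90` (kernel; the levels
  `120, 156, 180` are in the companion files, same method);
* `exceptional_complete_<N>` — the same in invariant form: **every exceptional quadruple `s` of level `N`
  (`IsExceptionalQuadruple N s`) is a unit multiple of a printed representative** (`∃ r ∈ reps N, ∃ t ∈ (ℤ/N)ˣ, s = t·r`), via the
  general lemma `exists_mem_reps_of_isExceptionalQuadruple` (sorting a 4-multiset by representatives).
Together with `level_<N>` of the base file (each printed representative is exceptional, the printed orbits are pairwise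
distinct, with the printed orbit sizes) this is a machine re-derivation of Tabelle 1 at its own levels. NOT certified here: that no
exceptional quadruple exists at the levels `N ≤ 180` absent from the table (the zeros of Shioda's `Δ`; a separate sweep), and
Aoki's theorem for `N > 180` (a printed theorem, [Aoki1983, Thm. C], not vendored).

METHOD (why this reaches `N = 180`). The statement quantifies over `(ℤ/N)³`; deciding it with the generic `Decidable` instances
(unit group of `ℤ/N` as a subtype of `ℤ/N × ℤ/N`, multiset arithmetic in `ZMod N`) is what exhausts the kernel at `N = 28`.
Here the search is a Boolean program over `ℕ` — `checkB N a₀ len`: for `a ∈ [a₀, a₀+len)`, `b ∈ [a, N)`, and `c` in the only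
possible window `max(b, N+1−a−b) ≤ c ≤ (2N−a−b)/2` (forced by `⟨c⟩ ≤ ⟨d⟩ ≤ N−1` and `Σ⟨·⟩ = 2N`, the Hodge condition at `t = 1`),
the Hodge test `hodgeB` runs over the list `unitsList N` of representatives coprime to `N` (bar `t = 1`, implied by the window) in `ℕ` arithmetic, and only for the
(few) Hodge quadruples the remaining predicates are decided on the actual multiset `quad N a b c ⊂ ℤ/N` (`restB`, with the unit
group again replaced by `unitsList`, `isStandardQuadruple_iff_unitsList`) — and a once-and-for-all SOUNDNESS THEOREM
`tabelleOneCompleteAt_of_chunks : (∀ chunks, checkB N a₀ len = true) → TabelleOneCompleteAt N` (bridge lemmas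
`isHodgeMultiset_iff_unitsList`, `sum_val_eq_of_isHodgeMultiset`, `hodgeB_of_isHodgeMultiset`, `quad_val`, `restB_of_checkB`).
Each `checkB … = true` is evaluated by `decide +kernel` (no `native_decide`, no additional axioms); the largest levels are split into
chunks of first entries `a` so that each kernel evaluation stays within memory (`N = 180`: 5 chunks, ≈ 1.7·10⁵ candidate triples,
≈ 2.5 min of kernel time; this file ≈ 2 min, each companion ≈ 3 min). An independent plain-Python enumeration of the same statement (cell `pub-hfermat`,
lit seat gen-3, `code/complete_check.py`) agrees at every level (0 counterexamples; exceptional multisets found = `Σ` printed orbit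
sizes: 8, 2, 8, 18, 26, 12, 38, 10, 98, 18, 16, 166, 16, 204, 30, 12, 32, 66, 24, 72, 24, 24).

HONEST FRAMING (cell `pub-hfermat`): explicit algebraic cycles for specific Hodge classes on Fermat/Delsarte varieties; residual open
instances listed; no claim on general Hodge. The classes tabulated here are algebraic (Lefschetz (1,1) on the Fermat surface
`X²_N`); what this file adds is only the kernel certificate that the printed LIST of exceptional classes is complete at its levels.

## References
* [MeyerNeutsch1981Fermatquadrupel] W. Meyer, W. Neutsch, *Fermatquadrupel*, Math. Ann. 256 (1981) 51–62: §2 p. 53 ("alle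
  Fermatquadrupel für N ≤ 614 ermittelt"), (13)–(15) p. 53, Tabelle 1 p. 54.
* [Shioda1982PicardFermat] T. Shioda, *On the Picard number of a Fermat surface*, J. Fac. Sci. Univ. Tokyo IA 28 (1982) 725–734:
  table of `Δ(m)` p. 727, Prop. 4 (Q') p. 729.
* [Aoki1983] N. Aoki, Math. Ann. 266 (1983) 23–54, Thm. C (no exceptional elements for `m > 180`).
* [Terasoma2018OpenFermat] T. Terasoma, arXiv:1801.01251, §6 (the orbit list with the multiset counts `e_m`).
* [Shioda1979PJA] T. Shioda, Proc. Japan Acad. 55A (1979) 111–114, §1 eqs. (2), (3) (the Hodge condition `Σ⟨t aᵢ⟩ = 2N`).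
-/

namespace Literature.AlgebraicGeometry.Shioda1982

open Literature.AlgebraicGeometry.HodgeTheory

variable {m : ℕ}

/-! ### The unit group of `ℤ/m` as a list of coprime representatives -/

/-- A `∀` over the units of `ℤ/m` is a `∀` over the residues whose representative is coprime to `m`
(`ZMod.unitOfCoprime`, `ZMod.val_coe_unit_coprime`). [folklore] -/
theorem forall_units_iff_coprime [NeZero m] (P : ZMod m → Prop) :
    (∀ t : (ZMod m)ˣ, P t) ↔ ∀ t : ZMod m, Nat.Coprime t.val m → P t := by
  constructor
  · intro h t ht
    simpa [ZMod.coe_unitOfCoprime, ZMod.natCast_zmod_val] using h (ZMod.unitOfCoprime t.val ht)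
  · intro h t
    exact h _ (ZMod.val_coe_unit_coprime t)

/-- An `∃` over the units of `ℤ/m` is an `∃` over the residues coprime to `m`. [folklore] -/
theorem exists_units_iff_coprime [NeZero m] (P : ZMod m → Prop) :
    (∃ t : (ZMod m)ˣ, P t) ↔ ∃ t : ZMod m, Nat.Coprime t.val m ∧ P t := by
  constructor
  · rintro ⟨t, ht⟩
    exact ⟨t, ZMod.val_coe_unit_coprime t, ht⟩
  · rintro ⟨t, ht, h⟩
    refine ⟨ZMod.unitOfCoprime t.val ht, ?_⟩
    simpa [ZMod.coe_unitOfCoprime, ZMod.natCast_zmod_val] using h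

/-- The units of `ℤ/m` as the list of representatives `t < m` with `gcd(t, m) = 1` (Meyer–Neutsch's group `𝔊_N`,
[MeyerNeutsch1981Fermatquadrupel, (5) p. 52]). [folklore] -/
def unitsList (m : ℕ) : List ℕ := (List.range m).filter fun t ↦ Nat.gcd t m = 1

/-- Membership in `unitsList`. [folklore] -/
theorem mem_unitsList {t : ℕ} : t ∈ unitsList m ↔ t < m ∧ Nat.Coprime t m := by
  simp [unitsList, List.mem_filter, List.mem_range, Nat.Coprime]

/-- A `∀` over the units of `ℤ/m` is a `∀` over `unitsList m`. [folklore] -/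
theorem forall_units_iff_unitsList [NeZero m] (P : ZMod m → Prop) :
    (∀ u : (ZMod m)ˣ, P u) ↔ ∀ t ∈ unitsList m, P (t : ZMod m) := by
  rw [forall_units_iff_coprime]
  constructor
  · intro h t ht
    rw [mem_unitsList] at ht
    exact h (t : ZMod m) (by rw [ZMod.val_natCast_of_lt ht.1]; exact ht.2)
  · intro h t ht
    have := h t.val (mem_unitsList.mpr ⟨ZMod.val_lt t, ht⟩)
    rwa [ZMod.natCast_zmod_val] at this

/-- An `∃` over the units of `ℤ/m` is an `∃` over `unitsList m`. [folklore] -/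
theorem exists_units_iff_unitsList [NeZero m] (P : ZMod m → Prop) :
    (∃ u : (ZMod m)ˣ, P u) ↔ ∃ t ∈ unitsList m, P (t : ZMod m) := by
  rw [exists_units_iff_coprime]
  constructor
  · rintro ⟨t, ht, h⟩
    exact ⟨t.val, mem_unitsList.mpr ⟨ZMod.val_lt t, ht⟩, by rwa [ZMod.natCast_zmod_val]⟩
  · rintro ⟨t, ht, h⟩
    rw [mem_unitsList] at ht
    exact ⟨(t : ZMod m), by rw [ZMod.val_natCast_of_lt ht.1]; exact ht.2, h⟩

/-- Shioda's `Σ ⟨t a⟩` after multiplication by a representative `t`, in `ℕ` arithmetic on representatives.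
[cite: Shioda1979PJA, §1 eq. (2)] -/
theorem mNormSum_map_mul_natCast [NeZero m] (s : Multiset (ZMod m)) {t : ℕ} (ht : t < m) :
    FermatCharacter.mNormSum (s.map fun a ↦ (t : ZMod m) * a) = ((s.map ZMod.val).map fun x ↦ t * x % m).sum := by
  simp [FermatCharacter.mNormSum, Multiset.map_map, ZMod.val_mul, ZMod.val_natCast_of_lt ht]

/-- The tree's Hodge condition `FermatCharacter.IsHodgeMultiset`, restated with the unit group as `unitsList` and the norm sums in
`ℕ` (an equivalent form that the kernel evaluates cheaply). [cite: Shioda1979PJA, §1 eqs. (2), (3)] -/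
theorem isHodgeMultiset_iff_unitsList [NeZero m] (s : Multiset (ZMod m)) :
    FermatCharacter.IsHodgeMultiset s ↔
      ((∀ a ∈ s, a ≠ 0) ∧ s.sum = 0) ∧
        ∀ t ∈ unitsList m, 2 * ((s.map ZMod.val).map fun x ↦ t * x % m).sum = m * Multiset.card s := by
  unfold FermatCharacter.IsHodgeMultiset
  refine Iff.rfl.and ?_
  rw [forall_units_iff_unitsList (m := m) (fun u ↦ 2 * FermatCharacter.mNormSum (s.map fun a ↦ u * a) = m * Multiset.card s)]
  refine forall₂_congr fun t ht ↦ ?_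
  rw [mNormSum_map_mul_natCast s (mem_unitsList.mp ht).1]

/-- `IsStandardQuadruple` with the unit group as `unitsList`. [cite: MeyerNeutsch1981Fermatquadrupel, p. 53 (Standardquadrupel "und ihre Bilder unter 𝔊_N × S₄")] -/
theorem isStandardQuadruple_iff_unitsList [NeZero m] (s : Multiset (ZMod m)) :
    IsStandardQuadruple m s ↔ ∃ t ∈ unitsList m,
      (2 ∣ m ∧ (s = (stdOne m).map (fun a ↦ (t : ZMod m) * a) ∨ s = (stdTwo m).map (fun a ↦ (t : ZMod m) * a))) ∨
        (3 ∣ m ∧ s = (stdThree m).map (fun a ↦ (t : ZMod m) * a)) := by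
  unfold IsStandardQuadruple
  exact exists_units_iff_unitsList (m := m) (fun u ↦
    (2 ∣ m ∧ (s = (stdOne m).map (fun a ↦ u * a) ∨ s = (stdTwo m).map (fun a ↦ u * a))) ∨
      (3 ∣ m ∧ s = (stdThree m).map (fun a ↦ u * a)))

/-- Decision procedure for `IsStandardQuadruple` over `unitsList` (replaces the generic enumeration of `(ℤ/m)ˣ`; same
proposition). [folklore] -/
instance (priority := high) decIsStandardQuadrupleFast [NeZero m] (s : Multiset (ZMod m)) :
    Decidable (IsStandardQuadruple m s) :=
  decidable_of_iff _ (isStandardQuadruple_iff_unitsList s).symm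

/-! ### The search procedure -/

/-- The Hodge test of a quadruple of representatives `(a, b, c, d)`, in `ℕ`: `Σᵢ ⟨t·xᵢ⟩ = 2N` for every `t` in
`unitsList N` except its head `t = 1` (Meyer–Neutsch's defining condition (4) of an "N-Fermatquadrupel", Shioda's equations (2) with
`y = 2`; the omitted condition at `t = 1`, `a + b + c + d = 2N`, holds by construction for every quadruple visited by `checkB`, and
for soundness only "Hodge ⇒ passes the test" is used, `hodgeB_of_isHodgeMultiset`).
[cite: MeyerNeutsch1981Fermatquadrupel, (4) p. 52] [cite: Shioda1979PJA, §1 eq. (2)] -/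
def hodgeB (N a b c d : ℕ) : Bool :=
  (unitsList N).tail.all fun t ↦ t * a % N + t * b % N + t * c % N + t * d % N == 2 * N

/-- The 4-multiset `{a, b, c, −(a+b+c)}` of residues mod `N` built from representatives `a, b, c ∈ ℕ`. [folklore] -/
def quad (N : ℕ) (a b c : ℕ) : Multiset (ZMod N) :=
  {(a : ZMod N), (b : ZMod N), (c : ZMod N), -((a : ZMod N) + (b : ZMod N) + (c : ZMod N))}

/-- The part of the test after the Hodge condition, decided on the actual multiset `quad N a b c ⊂ ℤ/N`: no pair and primitive
imply standard or in the `unitsList`-orbit of a printed representative. [cite: MeyerNeutsch1981Fermatquadrupel, p. 53 (trivial / Standard- / Ausnahmequadrupel) and Tabelle 1 p. 54] -/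
def restB (N : ℕ) [NeZero N] (a b c : ℕ) : Bool :=
  decide (¬ HasPair (quad N a b c) → IsPrimitive N (quad N a b c) →
    IsStandardQuadruple N (quad N a b c) ∨
      ∃ s ∈ reps N, ∃ t ∈ unitsList N, quad N a b c = s.map (fun x ↦ (t : ZMod N) * x))

/-- Lower end of the window for the third representative `c`: `c ≥ b` and `d = 2N − a − b − c ≤ N − 1`. [folklore] -/
def cLo (N a b : ℕ) : ℕ := max b (N + 1 - (a + b))

/-- Upper end of the window for `c`: `c ≤ d = 2N − a − b − c`. [folklore] -/
def cHi (N a b : ℕ) : ℕ := (2 * N - (a + b)) / 2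

/-- **The search at level `N` for first representatives `a ∈ [a₀, a₀ + len)`**: for every `b ∈ [a, N)` and every `c` in the
window `[cLo, cHi]`, with `d := 2N − (a+b+c)`, either `(a, b, c, d)` fails the Hodge test or `restB` holds (the computer searches of
Weidner / Meyer–Neutsch / Shioda–Maruyama, redone as a kernel-evaluable Boolean).
[cite: MeyerNeutsch1981Fermatquadrupel, §2 p. 53 ("alle Fermatquadrupel für N ≤ 614 ermittelt")] [cite: Shioda1982PicardFermat, table p. 727] -/
def checkB (N : ℕ) [NeZero N] (a0 len : ℕ) : Bool :=
  (List.range' a0 len).all fun a ↦ (List.range' a (N - a)).all fun b ↦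
    (List.range' (cLo N a b) (cHi N a b + 1 - cLo N a b)).all fun c ↦
      (!(hodgeB N a b c (2 * N - (a + b + c))) || restB N a b c)

/-- **Completeness of Tabelle 1 at level `N`** (sorted form): every Hodge 4-multiset `{a, b, c, −(a+b+c)}` of residues mod `N`,
listed with `⟨a⟩ ≤ ⟨b⟩ ≤ ⟨c⟩ ≤ ⟨−(a+b+c)⟩`, without a pair and with `gcd = 1`, is a standard quadruple or a unit multiple of a
representative printed in Tabelle 1 at level `N` (`reps N`). Every 4-multiset has such a sorted listing, and for a Hodge multiset the
last entry is `−(a+b+c)` (`Σ = 0`); the invariant form is `exists_mem_reps_of_isExceptionalQuadruple`.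
[cite: MeyerNeutsch1981Fermatquadrupel, §2 p. 53 and Tabelle 1 p. 54] [cite: Shioda1982PicardFermat, table p. 727] -/
def TabelleOneCompleteAt (N : ℕ) [NeZero N] : Prop :=
  ∀ a b c : ZMod N, a.val ≤ b.val → b.val ≤ c.val → c.val ≤ (-(a + b + c)).val →
    FermatCharacter.IsHodgeMultiset ({a, b, c, -(a + b + c)} : Multiset (ZMod N)) →
    ¬ HasPair ({a, b, c, -(a + b + c)} : Multiset (ZMod N)) → IsPrimitive N {a, b, c, -(a + b + c)} →
    IsStandardQuadruple N {a, b, c, -(a + b + c)} ∨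
      ∃ s ∈ reps N, ∃ t : (ZMod N)ˣ, ({a, b, c, -(a + b + c)} : Multiset (ZMod N)) = s.map (fun x ↦ (t : ZMod N) * x)

/-! ### Soundness of the search (the bridge from `checkB` to `TabelleOneCompleteAt`) -/

/-- For a Hodge 4-multiset the representatives sum to `2N` (the Hodge condition at `t = 1`; Shioda's length `y = 2`).
[cite: Shioda1979PJA, §1 eq. (2) with t = 1] -/
theorem sum_val_eq_of_isHodgeMultiset [NeZero m] {a b c d : ZMod m}
    (h : FermatCharacter.IsHodgeMultiset ({a, b, c, d} : Multiset (ZMod m))) :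
    a.val + b.val + c.val + d.val = 2 * m := by
  have := h.2 1
  simp [FermatCharacter.mNormSum, Multiset.insert_eq_cons] at this
  omega

/-- A Hodge 4-multiset passes the Boolean Hodge test `hodgeB` on its representatives. [cite: Shioda1979PJA, §1 eq. (2)] -/
theorem hodgeB_of_isHodgeMultiset [NeZero m] {a b c d : ZMod m}
    (h : FermatCharacter.IsHodgeMultiset ({a, b, c, d} : Multiset (ZMod m))) :
    hodgeB m a.val b.val c.val d.val = true := by
  rw [isHodgeMultiset_iff_unitsList] at h
  obtain ⟨-, h2⟩ := h
  unfold hodgeB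
  rw [List.all_eq_true]
  intro t ht
  have := h2 t (List.mem_of_mem_tail ht)
  simp [Multiset.insert_eq_cons] at this
  simp only [beq_iff_eq]
  omega

/-- `quad` of the representatives of `a, b, c` is the multiset `{a, b, c, −(a+b+c)}` itself. [folklore] -/
theorem quad_val [NeZero m] (a b c : ZMod m) : quad m a.val b.val c.val = {a, b, c, -(a + b + c)} := by
  simp [quad]

/-- Unpacking `checkB N a₀ len = true` at a visited triple `(a, b, c)`: if it passes `hodgeB`, then `restB N a b c = true`. [folklore] -/
theorem restB_of_checkB {N : ℕ} [NeZero N] {a0 len : ℕ} (h : checkB N a0 len = true) {a b c : ℕ}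
    (ha0 : a0 ≤ a) (ha1 : a < a0 + len) (hab : a ≤ b) (hb : b < N) (hbc : b ≤ c)
    (hlo : N + 1 ≤ a + b + c + (2 * N - (a + b + c)) ∧ 2 * N - (a + b + c) < N) (hcd : c ≤ 2 * N - (a + b + c))
    (hh : hodgeB N a b c (2 * N - (a + b + c)) = true) :
    restB N a b c = true := by
  unfold checkB at h
  rw [List.all_eq_true] at h
  have h1 := h a (List.mem_range'_1.mpr ⟨ha0, ha1⟩)
  rw [List.all_eq_true] at h1
  have h2 := h1 b (List.mem_range'_1.mpr ⟨hab, by omega⟩)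
  rw [List.all_eq_true] at h2
  have hclo : cLo N a b ≤ c := by unfold cLo; omega
  have hchi : c ≤ cHi N a b := by unfold cHi; omega
  have h3 := h2 c (List.mem_range'_1.mpr ⟨hclo, by omega⟩)
  simpa [hh] using h3

/-- **Soundness of the search.** If chunks `[a₀, a₀ + len)` covering all `a < N` all pass `checkB`, then Tabelle 1 is complete at
level `N` (`TabelleOneCompleteAt N`). The proof locates the sorted triple of representatives in the search (the window for `c`
from `Σ⟨·⟩ = 2N`, `sum_val_eq_of_isHodgeMultiset`), feeds the Hodge hypothesis to `hodgeB` (`hodgeB_of_isHodgeMultiset`), reads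
off `restB` and transports it back to `ℤ/N` (`quad_val`, `exists_units_iff_unitsList`). [folklore] -/
theorem tabelleOneCompleteAt_of_chunks (N : ℕ) [NeZero N] (chunks : List (ℕ × ℕ))
    (hcov : ∀ a, a < N → ∃ p ∈ chunks, p.1 ≤ a ∧ a < p.1 + p.2)
    (hs : ∀ p ∈ chunks, checkB N p.1 p.2 = true) : TabelleOneCompleteAt N := by
  intro a b c hab hbc hcd hH hP hG
  have ha := ZMod.val_lt a
  have hb := ZMod.val_lt b
  have hdlt := ZMod.val_lt (-(a + b + c))
  have hsum := sum_val_eq_of_isHodgeMultiset hH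
  have hd : (-(a + b + c)).val = 2 * N - (a.val + b.val + c.val) := by omega
  have hh := hodgeB_of_isHodgeMultiset hH
  rw [hd] at hh hcd hdlt
  obtain ⟨p, hp, hp0, hp1⟩ := hcov a.val ha
  have hr := restB_of_checkB (hs p hp) hp0 hp1 hab hb hbc ⟨by omega, hdlt⟩ hcd hh
  have hr' := of_decide_eq_true hr
  rw [quad_val] at hr'
  rcases hr' hP hG with hstd | ⟨s, hs, ht⟩
  · exact Or.inl hstd
  · exact Or.inr ⟨s, hs, (exists_units_iff_unitsList (m := N)
      (fun u ↦ ({a, b, c, -(a + b + c)} : Multiset (ZMod N)) = s.map (fun x ↦ u * x))).mpr ht⟩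

/-- **From the sorted form to arbitrary multisets.** If Tabelle 1 is complete at level `N` in the sense of `TabelleOneCompleteAt`,
then every exceptional quadruple `s` of level `N` (`IsExceptionalQuadruple N s`: four entries, Hodge, no pair, primitive, not
standard) is a unit multiple of a printed representative. (Sort the representatives of `s`; the largest is `−(sum of the others)`
by `Σ = 0`.) [cite: MeyerNeutsch1981Fermatquadrupel, Tabelle 1 p. 54 ("Aus jedem Transitivitätsbereich … genau ein Vertreter")] -/
theorem exists_mem_reps_of_isExceptionalQuadruple {N : ℕ} [NeZero N] (h : TabelleOneCompleteAt N)
    {s : Multiset (ZMod N)} (hs : IsExceptionalQuadruple N s) :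
    ∃ r ∈ reps N, ∃ t : (ZMod N)ˣ, s = r.map (fun x ↦ (t : ZMod N) * x) := by
  obtain ⟨hcard, hH, hP, hG, hnstd⟩ := hs
  obtain ⟨v, hvs, hsorted⟩ : ∃ v : List ℕ, (v : Multiset ℕ) = s.map ZMod.val ∧ v.Pairwise (· ≤ ·) :=
    ⟨(s.map ZMod.val).sort, Multiset.sort_eq _ _, Multiset.pairwise_sort _ _⟩
  have hlen : v.length = 4 := by
    have := congrArg Multiset.card hvs
    simpa [hcard] using this
  obtain ⟨a', b', c', d', rfl⟩ := List.length_eq_four.mp hlen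
  have hlt : ∀ x ∈ ([a', b', c', d'] : List ℕ), x < N := by
    intro x hx
    have hx' : x ∈ s.map ZMod.val := by rw [← hvs]; exact Multiset.mem_coe.mpr hx
    obtain ⟨y, -, rfl⟩ := Multiset.mem_map.mp hx'
    exact ZMod.val_lt y
  have ha' : a' < N := hlt a' (by simp)
  have hb' : b' < N := hlt b' (by simp)
  have hc' : c' < N := hlt c' (by simp)
  have hd' : d' < N := hlt d' (by simp)
  have hs' : s = {(a' : ZMod N), (b' : ZMod N), (c' : ZMod N), (d' : ZMod N)} := by
    have h1 : s = (s.map ZMod.val).map (fun n : ℕ ↦ (n : ZMod N)) := by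
      rw [Multiset.map_map]
      conv_lhs => rw [← Multiset.map_id s]
      refine Multiset.map_congr rfl fun x _ ↦ ?_
      simp
    rw [h1, ← hvs]
    rfl
  have hsum : (d' : ZMod N) = -((a' : ZMod N) + (b' : ZMod N) + (c' : ZMod N)) := by
    have h0 := hH.1.2
    rw [hs'] at h0
    simp only [Multiset.insert_eq_cons, Multiset.sum_cons, Multiset.sum_singleton] at h0
    linear_combination h0
  rw [hs', hsum] at hH hP hG hnstd ⊢
  have hab : (a' : ZMod N).val ≤ (b' : ZMod N).val := by
    rw [ZMod.val_natCast_of_lt ha', ZMod.val_natCast_of_lt hb']; simp at hsorted; omega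
  have hbc : (b' : ZMod N).val ≤ (c' : ZMod N).val := by
    rw [ZMod.val_natCast_of_lt hb', ZMod.val_natCast_of_lt hc']; simp at hsorted; omega
  have hcd : (c' : ZMod N).val ≤ (-((a' : ZMod N) + (b' : ZMod N) + (c' : ZMod N))).val := by
    rw [← hsum, ZMod.val_natCast_of_lt hc', ZMod.val_natCast_of_lt hd']; simp at hsorted; omega
  rcases h _ _ _ hab hbc hcd hH hP hG with hstd | htab
  · exact absurd hstd hnstd
  · exact htab

/-! ### The 19 levels `N ≤ 90`

For each level `N ≤ 90` of Tabelle 1 (levels `120, 156, 180`: companion files): `completeAt_<N> : TabelleOneCompleteAt N` by `tabelleOneCompleteAt_of_chunks` with every chunk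
`checkB N a₀ len = true` evaluated by `decide +kernel`, and the invariant form `exceptional_complete_<N>`. One chunk of first entries `a` per level
here. -/

set_option maxHeartbeats 0 in
/-- **Tabelle 1 is complete at `N = 12`** (2 printed orbit(s), `6` multisets): every sorted Hodge 4-multiset mod `12`
without a pair and with `gcd = 1` is standard or a unit multiple of a printed representative. Kernel exhaustion (`checkB`).
[cite: MeyerNeutsch1981Fermatquadrupel, Tabelle 1 p. 54 (N = 12), §2 p. 53] [cite: Shioda1982PicardFermat, table p. 727 (row m = 12)] -/
theorem completeAt_twelve : TabelleOneCompleteAt 12 :=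
  tabelleOneCompleteAt_of_chunks 12 [(0, 12)] (by decide +kernel) (by
    intro p hp
    rw [List.mem_singleton] at hp
    subst hp
    decide +kernel)

/-- Every exceptional quadruple of level `12` is a unit multiple of one of the 2 representative(s) printed in Tabelle 1.
[cite: MeyerNeutsch1981Fermatquadrupel, Tabelle 1 p. 54 (N = 12)] [cite: Terasoma2018OpenFermat, §6 (m = 12)] -/
theorem exceptional_complete_twelve (s : Multiset (ZMod 12)) (hs : IsExceptionalQuadruple 12 s) :
    ∃ r ∈ reps 12, ∃ t : (ZMod 12)ˣ, s = r.map (fun x ↦ (t : ZMod 12) * x) :=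
  exists_mem_reps_of_isExceptionalQuadruple completeAt_twelve hs

set_option maxHeartbeats 0 in
/-- **Tabelle 1 is complete at `N = 14`** (1 printed orbit(s), `2` multisets): every sorted Hodge 4-multiset mod `14`
without a pair and with `gcd = 1` is standard or a unit multiple of a printed representative. Kernel exhaustion (`checkB`).
[cite: MeyerNeutsch1981Fermatquadrupel, Tabelle 1 p. 54 (N = 14), §2 p. 53] [cite: Shioda1982PicardFermat, table p. 727 (row m = 14)] -/
theorem completeAt_fourteen : TabelleOneCompleteAt 14 :=
  tabelleOneCompleteAt_of_chunks 14 [(0, 14)] (by decide +kernel) (by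
    intro p hp
    rw [List.mem_singleton] at hp
    subst hp
    decide +kernel)

/-- Every exceptional quadruple of level `14` is a unit multiple of one of the 1 representative(s) printed in Tabelle 1.
[cite: MeyerNeutsch1981Fermatquadrupel, Tabelle 1 p. 54 (N = 14)] [cite: Terasoma2018OpenFermat, §6 (m = 14)] -/
theorem exceptional_complete_fourteen (s : Multiset (ZMod 14)) (hs : IsExceptionalQuadruple 14 s) :
    ∃ r ∈ reps 14, ∃ t : (ZMod 14)ˣ, s = r.map (fun x ↦ (t : ZMod 14) * x) :=
  exists_mem_reps_of_isExceptionalQuadruple completeAt_fourteen hs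

set_option maxHeartbeats 0 in
/-- **Tabelle 1 is complete at `N = 15`** (1 printed orbit(s), `8` multisets): every sorted Hodge 4-multiset mod `15`
without a pair and with `gcd = 1` is standard or a unit multiple of a printed representative. Kernel exhaustion (`checkB`).
[cite: MeyerNeutsch1981Fermatquadrupel, Tabelle 1 p. 54 (N = 15), §2 p. 53] [cite: Shioda1982PicardFermat, table p. 727 (row m = 15)] -/
theorem completeAt_fifteen : TabelleOneCompleteAt 15 :=
  tabelleOneCompleteAt_of_chunks 15 [(0, 15)] (by decide +kernel) (by
    intro p hp
    rw [List.mem_singleton] at hp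
    subst hp
    decide +kernel)

/-- Every exceptional quadruple of level `15` is a unit multiple of one of the 1 representative(s) printed in Tabelle 1.
[cite: MeyerNeutsch1981Fermatquadrupel, Tabelle 1 p. 54 (N = 15)] [cite: Terasoma2018OpenFermat, §6 (m = 15)] -/
theorem exceptional_complete_fifteen (s : Multiset (ZMod 15)) (hs : IsExceptionalQuadruple 15 s) :
    ∃ r ∈ reps 15, ∃ t : (ZMod 15)ˣ, s = r.map (fun x ↦ (t : ZMod 15) * x) :=
  exists_mem_reps_of_isExceptionalQuadruple completeAt_fifteen hs

set_option maxHeartbeats 0 in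
/-- **Tabelle 1 is complete at `N = 18`** (3 printed orbit(s), `18` multisets): every sorted Hodge 4-multiset mod `18`
without a pair and with `gcd = 1` is standard or a unit multiple of a printed representative. Kernel exhaustion (`checkB`).
[cite: MeyerNeutsch1981Fermatquadrupel, Tabelle 1 p. 54 (N = 18), §2 p. 53] [cite: Shioda1982PicardFermat, table p. 727 (row m = 18)] -/
theorem completeAt_eighteen : TabelleOneCompleteAt 18 :=
  tabelleOneCompleteAt_of_chunks 18 [(0, 18)] (by decide +kernel) (by
    intro p hp
    rw [List.mem_singleton] at hp
    subst hp
    decide +kernel)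

/-- Every exceptional quadruple of level `18` is a unit multiple of one of the 3 representative(s) printed in Tabelle 1.
[cite: MeyerNeutsch1981Fermatquadrupel, Tabelle 1 p. 54 (N = 18)] [cite: Terasoma2018OpenFermat, §6 (m = 18)] -/
theorem exceptional_complete_eighteen (s : Multiset (ZMod 18)) (hs : IsExceptionalQuadruple 18 s) :
    ∃ r ∈ reps 18, ∃ t : (ZMod 18)ˣ, s = r.map (fun x ↦ (t : ZMod 18) * x) :=
  exists_mem_reps_of_isExceptionalQuadruple completeAt_eighteen hs

set_option maxHeartbeats 0 in
/-- **Tabelle 1 is complete at `N = 20`** (4 printed orbit(s), `26` multisets): every sorted Hodge 4-multiset mod `20`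
without a pair and with `gcd = 1` is standard or a unit multiple of a printed representative. Kernel exhaustion (`checkB`).
[cite: MeyerNeutsch1981Fermatquadrupel, Tabelle 1 p. 54 (N = 20), §2 p. 53] [cite: Shioda1982PicardFermat, table p. 727 (row m = 20)] -/
theorem completeAt_twenty : TabelleOneCompleteAt 20 :=
  tabelleOneCompleteAt_of_chunks 20 [(0, 20)] (by decide +kernel) (by
    intro p hp
    rw [List.mem_singleton] at hp
    subst hp
    decide +kernel)

/-- Every exceptional quadruple of level `20` is a unit multiple of one of the 4 representative(s) printed in Tabelle 1.
[cite: MeyerNeutsch1981Fermatquadrupel, Tabelle 1 p. 54 (N = 20)] [cite: Terasoma2018OpenFermat, §6 (m = 20)] -/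
theorem exceptional_complete_twenty (s : Multiset (ZMod 20)) (hs : IsExceptionalQuadruple 20 s) :
    ∃ r ∈ reps 20, ∃ t : (ZMod 20)ˣ, s = r.map (fun x ↦ (t : ZMod 20) * x) :=
  exists_mem_reps_of_isExceptionalQuadruple completeAt_twenty hs

set_option maxHeartbeats 0 in
/-- **Tabelle 1 is complete at `N = 21`** (1 printed orbit(s), `12` multisets): every sorted Hodge 4-multiset mod `21`
without a pair and with `gcd = 1` is standard or a unit multiple of a printed representative. Kernel exhaustion (`checkB`).
[cite: MeyerNeutsch1981Fermatquadrupel, Tabelle 1 p. 54 (N = 21), §2 p. 53] [cite: Shioda1982PicardFermat, table p. 727 (row m = 21)] -/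
theorem completeAt_twentyOne : TabelleOneCompleteAt 21 :=
  tabelleOneCompleteAt_of_chunks 21 [(0, 21)] (by decide +kernel) (by
    intro p hp
    rw [List.mem_singleton] at hp
    subst hp
    decide +kernel)

/-- Every exceptional quadruple of level `21` is a unit multiple of one of the 1 representative(s) printed in Tabelle 1.
[cite: MeyerNeutsch1981Fermatquadrupel, Tabelle 1 p. 54 (N = 21)] [cite: Terasoma2018OpenFermat, §6 (m = 21)] -/
theorem exceptional_complete_twentyOne (s : Multiset (ZMod 21)) (hs : IsExceptionalQuadruple 21 s) :
    ∃ r ∈ reps 21, ∃ t : (ZMod 21)ˣ, s = r.map (fun x ↦ (t : ZMod 21) * x) :=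
  exists_mem_reps_of_isExceptionalQuadruple completeAt_twentyOne hs

set_option maxHeartbeats 0 in
/-- **Tabelle 1 is complete at `N = 24`** (8 printed orbit(s), `38` multisets): every sorted Hodge 4-multiset mod `24`
without a pair and with `gcd = 1` is standard or a unit multiple of a printed representative. Kernel exhaustion (`checkB`).
[cite: MeyerNeutsch1981Fermatquadrupel, Tabelle 1 p. 54 (N = 24), §2 p. 53] [cite: Shioda1982PicardFermat, table p. 727 (row m = 24)] -/
theorem completeAt_twentyFour : TabelleOneCompleteAt 24 :=
  tabelleOneCompleteAt_of_chunks 24 [(0, 24)] (by decide +kernel) (by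
    intro p hp
    rw [List.mem_singleton] at hp
    subst hp
    decide +kernel)

/-- Every exceptional quadruple of level `24` is a unit multiple of one of the 8 representative(s) printed in Tabelle 1.
[cite: MeyerNeutsch1981Fermatquadrupel, Tabelle 1 p. 54 (N = 24)] [cite: Terasoma2018OpenFermat, §6 (m = 24)] -/
theorem exceptional_complete_twentyFour (s : Multiset (ZMod 24)) (hs : IsExceptionalQuadruple 24 s) :
    ∃ r ∈ reps 24, ∃ t : (ZMod 24)ˣ, s = r.map (fun x ↦ (t : ZMod 24) * x) :=
  exists_mem_reps_of_isExceptionalQuadruple completeAt_twentyFour hs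

set_option maxHeartbeats 0 in
/-- **Tabelle 1 is complete at `N = 28`** (2 printed orbit(s), `10` multisets): every sorted Hodge 4-multiset mod `28`
without a pair and with `gcd = 1` is standard or a unit multiple of a printed representative. Kernel exhaustion (`checkB`).
[cite: MeyerNeutsch1981Fermatquadrupel, Tabelle 1 p. 54 (N = 28), §2 p. 53] [cite: Shioda1982PicardFermat, table p. 727 (row m = 28)] -/
theorem completeAt_twentyEight : TabelleOneCompleteAt 28 :=
  tabelleOneCompleteAt_of_chunks 28 [(0, 28)] (by decide +kernel) (by
    intro p hp
    rw [List.mem_singleton] at hp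
    subst hp
    decide +kernel)

/-- Every exceptional quadruple of level `28` is a unit multiple of one of the 2 representative(s) printed in Tabelle 1.
[cite: MeyerNeutsch1981Fermatquadrupel, Tabelle 1 p. 54 (N = 28)] [cite: Terasoma2018OpenFermat, §6 (m = 28)] -/
theorem exceptional_complete_twentyEight (s : Multiset (ZMod 28)) (hs : IsExceptionalQuadruple 28 s) :
    ∃ r ∈ reps 28, ∃ t : (ZMod 28)ˣ, s = r.map (fun x ↦ (t : ZMod 28) * x) :=
  exists_mem_reps_of_isExceptionalQuadruple completeAt_twentyEight hs

set_option maxHeartbeats 0 in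
/-- **Tabelle 1 is complete at `N = 30`** (15 printed orbit(s), `98` multisets): every sorted Hodge 4-multiset mod `30`
without a pair and with `gcd = 1` is standard or a unit multiple of a printed representative. Kernel exhaustion (`checkB`).
[cite: MeyerNeutsch1981Fermatquadrupel, Tabelle 1 p. 54 (N = 30), §2 p. 53] [cite: Shioda1982PicardFermat, table p. 727 (row m = 30)] -/
theorem completeAt_thirty : TabelleOneCompleteAt 30 :=
  tabelleOneCompleteAt_of_chunks 30 [(0, 30)] (by decide +kernel) (by
    intro p hp
    rw [List.mem_singleton] at hp
    subst hp
    decide +kernel)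

/-- Every exceptional quadruple of level `30` is a unit multiple of one of the 15 representative(s) printed in Tabelle 1.
[cite: MeyerNeutsch1981Fermatquadrupel, Tabelle 1 p. 54 (N = 30)] [cite: Terasoma2018OpenFermat, §6 (m = 30)] -/
theorem exceptional_complete_thirty (s : Multiset (ZMod 30)) (hs : IsExceptionalQuadruple 30 s) :
    ∃ r ∈ reps 30, ∃ t : (ZMod 30)ˣ, s = r.map (fun x ↦ (t : ZMod 30) * x) :=
  exists_mem_reps_of_isExceptionalQuadruple completeAt_thirty hs

set_option maxHeartbeats 0 in
/-- **Tabelle 1 is complete at `N = 36`** (2 printed orbit(s), `18` multisets): every sorted Hodge 4-multiset mod `36`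
without a pair and with `gcd = 1` is standard or a unit multiple of a printed representative. Kernel exhaustion (`checkB`).
[cite: MeyerNeutsch1981Fermatquadrupel, Tabelle 1 p. 54 (N = 36), §2 p. 53] [cite: Shioda1982PicardFermat, table p. 727 (row m = 36)] -/
theorem completeAt_thirtySix : TabelleOneCompleteAt 36 :=
  tabelleOneCompleteAt_of_chunks 36 [(0, 36)] (by decide +kernel) (by
    intro p hp
    rw [List.mem_singleton] at hp
    subst hp
    decide +kernel)

/-- Every exceptional quadruple of level `36` is a unit multiple of one of the 2 representative(s) printed in Tabelle 1.
[cite: MeyerNeutsch1981Fermatquadrupel, Tabelle 1 p. 54 (N = 36)] [cite: Terasoma2018OpenFermat, §6 (m = 36)] -/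
theorem exceptional_complete_thirtySix (s : Multiset (ZMod 36)) (hs : IsExceptionalQuadruple 36 s) :
    ∃ r ∈ reps 36, ∃ t : (ZMod 36)ˣ, s = r.map (fun x ↦ (t : ZMod 36) * x) :=
  exists_mem_reps_of_isExceptionalQuadruple completeAt_thirtySix hs

set_option maxHeartbeats 0 in
/-- **Tabelle 1 is complete at `N = 40`** (2 printed orbit(s), `16` multisets): every sorted Hodge 4-multiset mod `40`
without a pair and with `gcd = 1` is standard or a unit multiple of a printed representative. Kernel exhaustion (`checkB`).
[cite: MeyerNeutsch1981Fermatquadrupel, Tabelle 1 p. 54 (N = 40), §2 p. 53] [cite: Shioda1982PicardFermat, table p. 727 (row m = 40)] -/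
theorem completeAt_forty : TabelleOneCompleteAt 40 :=
  tabelleOneCompleteAt_of_chunks 40 [(0, 40)] (by decide +kernel) (by
    intro p hp
    rw [List.mem_singleton] at hp
    subst hp
    decide +kernel)

/-- Every exceptional quadruple of level `40` is a unit multiple of one of the 2 representative(s) printed in Tabelle 1.
[cite: MeyerNeutsch1981Fermatquadrupel, Tabelle 1 p. 54 (N = 40)] [cite: Terasoma2018OpenFermat, §6 (m = 40)] -/
theorem exceptional_complete_forty (s : Multiset (ZMod 40)) (hs : IsExceptionalQuadruple 40 s) :
    ∃ r ∈ reps 40, ∃ t : (ZMod 40)ˣ, s = r.map (fun x ↦ (t : ZMod 40) * x) :=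
  exists_mem_reps_of_isExceptionalQuadruple completeAt_forty hs

set_option maxHeartbeats 0 in
/-- **Tabelle 1 is complete at `N = 42`** (16 printed orbit(s), `166` multisets): every sorted Hodge 4-multiset mod `42`
without a pair and with `gcd = 1` is standard or a unit multiple of a printed representative. Kernel exhaustion (`checkB`).
[cite: MeyerNeutsch1981Fermatquadrupel, Tabelle 1 p. 54 (N = 42), §2 p. 53] [cite: Shioda1982PicardFermat, table p. 727 (row m = 42)] -/
theorem completeAt_fortyTwo : TabelleOneCompleteAt 42 :=
  tabelleOneCompleteAt_of_chunks 42 [(0, 42)] (by decide +kernel) (by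
    intro p hp
    rw [List.mem_singleton] at hp
    subst hp
    decide +kernel)

/-- Every exceptional quadruple of level `42` is a unit multiple of one of the 16 representative(s) printed in Tabelle 1.
[cite: MeyerNeutsch1981Fermatquadrupel, Tabelle 1 p. 54 (N = 42)] [cite: Terasoma2018OpenFermat, §6 (m = 42)] -/
theorem exceptional_complete_fortyTwo (s : Multiset (ZMod 42)) (hs : IsExceptionalQuadruple 42 s) :
    ∃ r ∈ reps 42, ∃ t : (ZMod 42)ˣ, s = r.map (fun x ↦ (t : ZMod 42) * x) :=
  exists_mem_reps_of_isExceptionalQuadruple completeAt_fortyTwo hs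

set_option maxHeartbeats 0 in
/-- **Tabelle 1 is complete at `N = 48`** (2 printed orbit(s), `16` multisets): every sorted Hodge 4-multiset mod `48`
without a pair and with `gcd = 1` is standard or a unit multiple of a printed representative. Kernel exhaustion (`checkB`).
[cite: MeyerNeutsch1981Fermatquadrupel, Tabelle 1 p. 54 (N = 48), §2 p. 53] [cite: Shioda1982PicardFermat, table p. 727 (row m = 48)] -/
theorem completeAt_fortyEight : TabelleOneCompleteAt 48 :=
  tabelleOneCompleteAt_of_chunks 48 [(0, 48)] (by decide +kernel) (by
    intro p hp
    rw [List.mem_singleton] at hp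
    subst hp
    decide +kernel)

/-- Every exceptional quadruple of level `48` is a unit multiple of one of the 2 representative(s) printed in Tabelle 1.
[cite: MeyerNeutsch1981Fermatquadrupel, Tabelle 1 p. 54 (N = 48)] [cite: Terasoma2018OpenFermat, §6 (m = 48)] -/
theorem exceptional_complete_fortyEight (s : Multiset (ZMod 48)) (hs : IsExceptionalQuadruple 48 s) :
    ∃ r ∈ reps 48, ∃ t : (ZMod 48)ˣ, s = r.map (fun x ↦ (t : ZMod 48) * x) :=
  exists_mem_reps_of_isExceptionalQuadruple completeAt_fortyEight hs

set_option maxHeartbeats 0 in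
/-- **Tabelle 1 is complete at `N = 60`** (23 printed orbit(s), `204` multisets): every sorted Hodge 4-multiset mod `60`
without a pair and with `gcd = 1` is standard or a unit multiple of a printed representative. Kernel exhaustion (`checkB`).
[cite: MeyerNeutsch1981Fermatquadrupel, Tabelle 1 p. 54 (N = 60), §2 p. 53] [cite: Shioda1982PicardFermat, table p. 727 (row m = 60)] -/
theorem completeAt_sixty : TabelleOneCompleteAt 60 :=
  tabelleOneCompleteAt_of_chunks 60 [(0, 60)] (by decide +kernel) (by
    intro p hp
    rw [List.mem_singleton] at hp
    subst hp
    decide +kernel)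

/-- Every exceptional quadruple of level `60` is a unit multiple of one of the 23 representative(s) printed in Tabelle 1.
[cite: MeyerNeutsch1981Fermatquadrupel, Tabelle 1 p. 54 (N = 60)] [cite: Terasoma2018OpenFermat, §6 (m = 60)] -/
theorem exceptional_complete_sixty (s : Multiset (ZMod 60)) (hs : IsExceptionalQuadruple 60 s) :
    ∃ r ∈ reps 60, ∃ t : (ZMod 60)ˣ, s = r.map (fun x ↦ (t : ZMod 60) * x) :=
  exists_mem_reps_of_isExceptionalQuadruple completeAt_sixty hs

set_option maxHeartbeats 0 in
/-- **Tabelle 1 is complete at `N = 66`** (2 printed orbit(s), `30` multisets): every sorted Hodge 4-multiset mod `66`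
without a pair and with `gcd = 1` is standard or a unit multiple of a printed representative. Kernel exhaustion (`checkB`).
[cite: MeyerNeutsch1981Fermatquadrupel, Tabelle 1 p. 54 (N = 66), §2 p. 53] [cite: Shioda1982PicardFermat, table p. 727 (row m = 66)] -/
theorem completeAt_sixtySix : TabelleOneCompleteAt 66 :=
  tabelleOneCompleteAt_of_chunks 66 [(0, 66)] (by decide +kernel) (by
    intro p hp
    rw [List.mem_singleton] at hp
    subst hp
    decide +kernel)

/-- Every exceptional quadruple of level `66` is a unit multiple of one of the 2 representative(s) printed in Tabelle 1.
[cite: MeyerNeutsch1981Fermatquadrupel, Tabelle 1 p. 54 (N = 66)] [cite: Terasoma2018OpenFermat, §6 (m = 66)] -/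
theorem exceptional_complete_sixtySix (s : Multiset (ZMod 66)) (hs : IsExceptionalQuadruple 66 s) :
    ∃ r ∈ reps 66, ∃ t : (ZMod 66)ˣ, s = r.map (fun x ↦ (t : ZMod 66) * x) :=
  exists_mem_reps_of_isExceptionalQuadruple completeAt_sixtySix hs

set_option maxHeartbeats 0 in
/-- **Tabelle 1 is complete at `N = 72`** (1 printed orbit(s), `12` multisets): every sorted Hodge 4-multiset mod `72`
without a pair and with `gcd = 1` is standard or a unit multiple of a printed representative. Kernel exhaustion (`checkB`).
[cite: MeyerNeutsch1981Fermatquadrupel, Tabelle 1 p. 54 (N = 72), §2 p. 53] [cite: Shioda1982PicardFermat, table p. 727 (row m = 72)] -/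
theorem completeAt_seventyTwo : TabelleOneCompleteAt 72 :=
  tabelleOneCompleteAt_of_chunks 72 [(0, 72)] (by decide +kernel) (by
    intro p hp
    rw [List.mem_singleton] at hp
    subst hp
    decide +kernel)

/-- Every exceptional quadruple of level `72` is a unit multiple of one of the 1 representative(s) printed in Tabelle 1.
[cite: MeyerNeutsch1981Fermatquadrupel, Tabelle 1 p. 54 (N = 72)] [cite: Terasoma2018OpenFermat, §6 (m = 72)] -/
theorem exceptional_complete_seventyTwo (s : Multiset (ZMod 72)) (hs : IsExceptionalQuadruple 72 s) :
    ∃ r ∈ reps 72, ∃ t : (ZMod 72)ˣ, s = r.map (fun x ↦ (t : ZMod 72) * x) :=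
  exists_mem_reps_of_isExceptionalQuadruple completeAt_seventyTwo hs

set_option maxHeartbeats 0 in
/-- **Tabelle 1 is complete at `N = 78`** (2 printed orbit(s), `32` multisets): every sorted Hodge 4-multiset mod `78`
without a pair and with `gcd = 1` is standard or a unit multiple of a printed representative. Kernel exhaustion (`checkB`).
[cite: MeyerNeutsch1981Fermatquadrupel, Tabelle 1 p. 54 (N = 78), §2 p. 53] [cite: Shioda1982PicardFermat, table p. 727 (row m = 78)] -/
theorem completeAt_seventyEight : TabelleOneCompleteAt 78 :=
  tabelleOneCompleteAt_of_chunks 78 [(0, 78)] (by decide +kernel) (by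
    intro p hp
    rw [List.mem_singleton] at hp
    subst hp
    decide +kernel)

/-- Every exceptional quadruple of level `78` is a unit multiple of one of the 2 representative(s) printed in Tabelle 1.
[cite: MeyerNeutsch1981Fermatquadrupel, Tabelle 1 p. 54 (N = 78)] [cite: Terasoma2018OpenFermat, §6 (m = 78)] -/
theorem exceptional_complete_seventyEight (s : Multiset (ZMod 78)) (hs : IsExceptionalQuadruple 78 s) :
    ∃ r ∈ reps 78, ∃ t : (ZMod 78)ˣ, s = r.map (fun x ↦ (t : ZMod 78) * x) :=
  exists_mem_reps_of_isExceptionalQuadruple completeAt_seventyEight hs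

set_option maxHeartbeats 0 in
/-- **Tabelle 1 is complete at `N = 84`** (6 printed orbit(s), `66` multisets): every sorted Hodge 4-multiset mod `84`
without a pair and with `gcd = 1` is standard or a unit multiple of a printed representative. Kernel exhaustion (`checkB`).
[cite: MeyerNeutsch1981Fermatquadrupel, Tabelle 1 p. 54 (N = 84), §2 p. 53] [cite: Shioda1982PicardFermat, table p. 727 (row m = 84)] -/
theorem completeAt_eightyFour : TabelleOneCompleteAt 84 :=
  tabelleOneCompleteAt_of_chunks 84 [(0, 84)] (by decide +kernel) (by
    intro p hp
    rw [List.mem_singleton] at hp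
    subst hp
    decide +kernel)

/-- Every exceptional quadruple of level `84` is a unit multiple of one of the 6 representative(s) printed in Tabelle 1.
[cite: MeyerNeutsch1981Fermatquadrupel, Tabelle 1 p. 54 (N = 84)] [cite: Terasoma2018OpenFermat, §6 (m = 84)] -/
theorem exceptional_complete_eightyFour (s : Multiset (ZMod 84)) (hs : IsExceptionalQuadruple 84 s) :
    ∃ r ∈ reps 84, ∃ t : (ZMod 84)ˣ, s = r.map (fun x ↦ (t : ZMod 84) * x) :=
  exists_mem_reps_of_isExceptionalQuadruple completeAt_eightyFour hs

set_option maxHeartbeats 0 in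
/-- **Tabelle 1 is complete at `N = 90`** (1 printed orbit(s), `24` multisets): every sorted Hodge 4-multiset mod `90`
without a pair and with `gcd = 1` is standard or a unit multiple of a printed representative. Kernel exhaustion (`checkB`).
[cite: MeyerNeutsch1981Fermatquadrupel, Tabelle 1 p. 54 (N = 90), §2 p. 53] [cite: Shioda1982PicardFermat, table p. 727 (row m = 90)] -/
theorem completeAt_ninety : TabelleOneCompleteAt 90 :=
  tabelleOneCompleteAt_of_chunks 90 [(0, 90)] (by decide +kernel) (by
    intro p hp
    rw [List.mem_singleton] at hp
    subst hp
    decide +kernel)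

/-- Every exceptional quadruple of level `90` is a unit multiple of one of the 1 representative(s) printed in Tabelle 1.
[cite: MeyerNeutsch1981Fermatquadrupel, Tabelle 1 p. 54 (N = 90)] [cite: Terasoma2018OpenFermat, §6 (m = 90)] -/
theorem exceptional_complete_ninety (s : Multiset (ZMod 90)) (hs : IsExceptionalQuadruple 90 s) :
    ∃ r ∈ reps 90, ∃ t : (ZMod 90)ˣ, s = r.map (fun x ↦ (t : ZMod 90) * x) :=
  exists_mem_reps_of_isExceptionalQuadruple completeAt_ninety hs

end Literature.AlgebraicGeometry.Shioda1982
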